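import Literature.Probability.Percolation.ArmSeparationExtArm
import Literature.Probability.Percolation.ArmSeparationSpoke
import Literature.Probability.Percolation.LandedAltFourArm
import HarnessLib

/-!
# Four alternating arms landed on the sides `0, 2, 3, 5`: the events of the near-critical four-arm separation

Topic `Literature/Probability/Percolation`; family `crit-perc` / near-critical percolation on `𝕋`.
A brick of the near-critical arm-separation theorem for four arms of alternating colours
(P. Nolin, *Near-critical percolation in two dimensions*, EJP 13 (2008), Thm. 11 for `j = 4`,
`σ = BWBW` [arXiv 0711.4948: Thm. 10]; H. Kesten, CMP 109 (1987), Lemmas 4–6), the input of the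
tree's alternating four-arm calculus (`altFourArm`, `AltFourArm.lean`; `sepFourArm`,
`ArmSeparationFourArm.lean`). It introduces the LANDED events of the multi-scale scheme of §4.4 for
four arms and records what the square Hex lemma says about them.

**Landing pattern.** The open arms land on the opposite vertical sides `0`, `3` of the hexagon
`∂Λ_N` and the closed arms on the opposite horizontal sides `2`, `5` (in cyclic order the colours
alternate). These four sides are the right sides of the four frames `frameIso 0 = id`,
`frameIso 2 = σ` (transposition), `frameIso 3 = -id`, `frameIso 5 = -σ`
(`ArmSeparationInnerFrames.lean`), which map coordinate boxes to coordinate boxes, so that every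
fence, tube and corridor of the separation argument is an axis-parallel box of `𝕋`; an arm of
colour `b` landed on the side `i ∈ {0, 2, 3, 5}` of `ω` is an open arm landed on the right side of the
configuration `frameConfig i ω` (`b = open`) resp. `frameConfig i ωᶜ` (`b = closed`), i.e. a member
of the tree's one-arm events `extOpenArm n N` / `sepOpenArm n N` (`ArmSeparationExtArm.lean`,
`ArmSeparation.lean`). Nolin's theorem is uniform in the landing sequence (Thm. 11: "uniformly in
all landing sequences `I/I'`"); the sides `1, 4` used by `sepFourArm` are reached from these at the
very end by one fixed relocation.

* `extFourArmQ n N` — **four alternating arms from `∂Λ_n` landed on the sides `0, 2, 3, 5` of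
  `∂Λ_N` with outer free spaces** (Nolin's `Ã̃^{·/η', I'}_{4,BWBW}(n, N)`, p. 13, `η' = 1/64`):
  `ω`, `frameConfig 3 ω ∈ extOpenArm n N` (open arms on the sides `0`, `3`) and
  `frameConfig 2 ωᶜ`, `frameConfig 5 ωᶜ ∈ extOpenArm n N` (closed arms on the sides `2`, `5`);
* `sepFourArmQ n N` — the same with inner free spaces on `∂Λ_n` as well (`sepOpenArm`), Nolin's
  `Ã̃^{η, I/η', I'}_{4,BWBW}(n, N)`;
* `sepFourArmQ_subset_extFourArmQ`, `extFourArmQ_mono` (longer arms contain shorter ones),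
  locality `determinedBy_extFourArmQ` and measurability;
* frame algebra of the four box-preserving frames (`frameIso_two_two`, `frameConfig_two_two`, `frameConfig_five_two`, `frameConfig_two_three`, …);
* **`hexQ_open_excl`** — if the two CLOSED arms are present (landed on the sides `2`, `5` of `∂Λ_N`,
  from `∂Λ_m`), no OPEN connected set outside the hole `Λ_{m-1}` and inside the horizontal strip
  `|x₁| ≤ N` joins `{x₀ ≤ -N}` to `{x₀ ≥ N}`: the closed arms continued through the hole would give a
  white bottom–top crossing of `[-N, N]²` disjoint from the black left–right one
  (`tri_hex_excl_triSqBox`, Bollobás–Riordan 2006, Ch. 5, Lemma 7);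
  **`hexQ_closed_excl`** — the same with colours and axes exchanged (through `σ`). This is how the
  two open (closed) arms of `extFourArmQ` are known to lie in different open (closed) clusters,
  without confining sets and without a Jordan curve theorem.

Everything here is proved; no named facts are introduced.

## References

* P. Nolin, Near-critical percolation in two dimensions, *Electron. J. Probab.* 13 (2008), §4.2
  Def. 6–8 (free spaces, landing sequences, `Ã̃`), §4.3 Thm. 11, §4.4 (arXiv 0711.4948: Def. 6–8,
  Thm. 10, pp. 11–13) [Nolin2008].
* H. Kesten, Scaling relations for 2D-percolation, *Comm. Math. Phys.* 109 (1987), Lemmas 4–6 [Kesten1987].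
* B. Bollobás, O. Riordan, *Percolation*, CUP (2006), Ch. 5, Lemma 7 [BollobasRiordan2006].

Tree: `extOpenArm`, `extOpenArm_mono`, `determinedBy_extOpenArm`, `extSupportSet`,
`sepOpenArm_subset_extOpenArm` (`ArmSeparationExtArm.lean`); `sepOpenArm`, `sepLanding`,
`sepOuterFence` (`ArmSeparation.lean`); `frameIso`, `frameConfig`, `frameIso_apply_formula`,
`pathIn_of_frameConfig`, `triNorm_frameIso` (`ArmSeparationInnerFrames.lean`);
`determinedBy_preimage_frameConfig` (`ArmSeparationSpoke.lean`); `tri_hex_excl_triSqBox`, `triSqBox`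
(`CutPointArms.lean`); `pathIn_triBall`, `exists_adj_mem_triBall_sub_one` (`LandedAltFourArm.lean`).
-/

noncomputable section

open Set MeasureTheory

namespace Literature.Probability.Percolation

open LatticeModels

/-! ### Frame algebra of the box-preserving frames `0, 2, 3, 5` -/

/-- `σ² = id`. [folklore] -/
theorem frameIso_two_two (v : Site 2) : frameIso 2 (frameIso 2 v) = v := by
  obtain ⟨-, -, -, -, a0, a1, -⟩ := frameIso_apply_formula (frameIso 2 v)
  obtain ⟨-, -, -, -, b0, b1, -⟩ := frameIso_apply_formula v
  exact Site.eq_iff_two.2 ⟨by rw [a0, b1], by rw [a1, b0]⟩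

/-- `(-id)² = id`. [folklore] -/
theorem frameIso_three_three (v : Site 2) : frameIso 3 (frameIso 3 v) = v := by
  obtain ⟨-, -, -, -, -, -, a0, a1, -⟩ := frameIso_apply_formula (frameIso 3 v)
  obtain ⟨-, -, -, -, -, -, b0, b1, -⟩ := frameIso_apply_formula v
  exact Site.eq_iff_two.2 ⟨by rw [a0, b0]; ring, by rw [a1, b1]; ring⟩

/-- `σ ∘ (-σ) = -id`. [folklore] -/
theorem frameIso_two_five (v : Site 2) : frameIso 2 (frameIso 5 v) = frameIso 3 v := by
  obtain ⟨-, -, -, -, a0, a1, -⟩ := frameIso_apply_formula (frameIso 5 v)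
  obtain ⟨-, -, -, -, -, -, b0, b1, -, -, c0, c1⟩ := frameIso_apply_formula v
  exact Site.eq_iff_two.2 ⟨by rw [a0, c1, b0], by rw [a1, c0, b1]⟩

/-- `(-σ) ∘ σ = -id`. [folklore] -/
theorem frameIso_five_two (v : Site 2) : frameIso 5 (frameIso 2 v) = frameIso 3 v := by
  obtain ⟨-, -, -, -, -, -, -, -, -, -, a0, a1⟩ := frameIso_apply_formula (frameIso 2 v)
  obtain ⟨-, -, -, -, b0, b1, c0, c1, -⟩ := frameIso_apply_formula v
  exact Site.eq_iff_two.2 ⟨by rw [a0, b1, c0], by rw [a1, b0, c1]⟩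

/-- `σ ∘ (-id) = -σ`. [folklore] -/
theorem frameIso_two_three (v : Site 2) : frameIso 2 (frameIso 3 v) = frameIso 5 v := by
  obtain ⟨-, -, -, -, a0, a1, -⟩ := frameIso_apply_formula (frameIso 3 v)
  obtain ⟨-, -, -, -, -, -, b0, b1, -, -, c0, c1⟩ := frameIso_apply_formula v
  exact Site.eq_iff_two.2 ⟨by rw [a0, b1, c0], by rw [a1, b0, c1]⟩

/-- Composition of frames: `frameConfig i (frameConfig j ω) = {v | frameIso j (frameIso i v) ∈ ω}`. [folklore] -/
theorem mem_frameConfig_frameConfig {i j : ℕ} {ω : SiteConfig (Site 2)} {v : Site 2} :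
    v ∈ frameConfig i (frameConfig j ω) ↔ frameIso j (frameIso i v) ∈ ω := by
  rw [mem_frameConfig, mem_frameConfig]

/-- `frameConfig 2` is an involution. [folklore] -/
theorem frameConfig_two_two (ω : SiteConfig (Site 2)) : frameConfig 2 (frameConfig 2 ω) = ω := by
  ext v; rw [mem_frameConfig_frameConfig, frameIso_two_two]

/-- `frameConfig 3` is an involution. [folklore] -/
theorem frameConfig_three_three (ω : SiteConfig (Site 2)) : frameConfig 3 (frameConfig 3 ω) = ω := by
  ext v; rw [mem_frameConfig_frameConfig, frameIso_three_three]

/-- `frameConfig 5 ∘ frameConfig 2 = frameConfig 3`. [folklore] -/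
theorem frameConfig_five_two (ω : SiteConfig (Site 2)) : frameConfig 5 (frameConfig 2 ω) = frameConfig 3 ω := by
  ext v; rw [mem_frameConfig_frameConfig, frameIso_two_five, mem_frameConfig]

/-- `frameConfig 2 ∘ frameConfig 3 = frameConfig 5`. [folklore] -/
theorem frameConfig_two_three (ω : SiteConfig (Site 2)) : frameConfig 2 (frameConfig 3 ω) = frameConfig 5 ω := by
  ext v
  rw [mem_frameConfig_frameConfig, mem_frameConfig]
  obtain ⟨-, -, -, -, -, -, a0, a1, -⟩ := frameIso_apply_formula (frameIso 2 v)
  obtain ⟨-, -, -, -, b0, b1, -, -, -, -, c0, c1⟩ := frameIso_apply_formula v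
  have : frameIso 3 (frameIso 2 v) = frameIso 5 v := Site.eq_iff_two.2 ⟨by rw [a0, b0, c0], by rw [a1, b1, c1]⟩
  rw [this]

/-- `frameConfig 3 ∘ frameConfig 2 = frameConfig 5`. [folklore] -/
theorem frameConfig_three_two (ω : SiteConfig (Site 2)) : frameConfig 3 (frameConfig 2 ω) = frameConfig 5 ω := by
  ext v; rw [mem_frameConfig_frameConfig, frameIso_two_three, mem_frameConfig]

/-! ### The events -/

/-- **Four alternating arms from `∂Λ_n` landed on the sides `0, 2, 3, 5` of `∂Λ_N`** (the
`j = 4`, `σ = BWBW` instance of Nolin's arms "well-separated and landed on the external boundary",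
`Ã̃^{·/η',I'}_{j,σ}(n, N)` with `η' = 1/64`, relaxed as in `extOpenArm`): an open arm landed with
its free space on the middle half of the right side of `∂Λ_N` (`ω ∈ extOpenArm n N`), a closed
arm landed on the top side (an open landed arm of `frameConfig 2 ωᶜ`, the colour-exchanged
configuration read through the transposition), an open arm landed on the left side
(`frameConfig 3 ω`, central symmetry) and a closed arm landed on the bottom side
(`frameConfig 5 ωᶜ`). [cite: Nolin2008, §4.2 Def. 6–8 and §4.4 (arXiv 0711.4948: Def. 6–8; proof of Thm. 10, p. 13)] -/
def extFourArmQ (n N : ℕ) : Set (SiteConfig (Site 2)) :=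
  {ω | ω ∈ extOpenArm n N ∧ frameConfig 2 ωᶜ ∈ extOpenArm n N ∧ frameConfig 3 ω ∈ extOpenArm n N ∧
    frameConfig 5 ωᶜ ∈ extOpenArm n N}

/-- **Four well-separated alternating arms with landing areas on the sides `0, 2, 3, 5`** (Nolin's
`Ã̃^{η,I/η',I'}_{4,BWBW}(n, N)`, `η = η' = 1/64`, landing areas the middle halves of the sides
`0` (open), `2` (closed), `3` (open), `5` (closed) of `∂Λ_n` and of `∂Λ_N`, relaxed as in
`sepOpenArm`): each of the four framed configurations carries a fenced open arm landing on the
right (`sepOpenArm n N`). [cite: Nolin2008, §4.2 Def. 6–8 (arXiv 0711.4948: Def. 6–8)] -/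
def sepFourArmQ (n N : ℕ) : Set (SiteConfig (Site 2)) :=
  {ω | ω ∈ sepOpenArm n N ∧ frameConfig 2 ωᶜ ∈ sepOpenArm n N ∧ frameConfig 3 ω ∈ sepOpenArm n N ∧
    frameConfig 5 ωᶜ ∈ sepOpenArm n N}

/-- Arms landed at both ends are landed at the outer end (`2n ≤ N`). [folklore] -/
theorem sepFourArmQ_subset_extFourArmQ {n N : ℕ} (hnN : 2 * n ≤ N) : sepFourArmQ n N ⊆ extFourArmQ n N :=
  fun _ ⟨h0, h2, h3, h5⟩ =>
    ⟨sepOpenArm_subset_extOpenArm hnN h0, sepOpenArm_subset_extOpenArm hnN h2, sepOpenArm_subset_extOpenArm hnN h3,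
      sepOpenArm_subset_extOpenArm hnN h5⟩

/-- **Longer arms contain shorter ones**: `extFourArmQ n N ⊆ extFourArmQ n' N` for `n ≤ n' ≤ N`. [folklore] -/
theorem extFourArmQ_mono {n n' N : ℕ} (hnn' : n ≤ n') (hn'N : n' ≤ N) : extFourArmQ n N ⊆ extFourArmQ n' N :=
  fun _ ⟨h0, h2, h3, h5⟩ =>
    ⟨extOpenArm_mono hnn' hn'N h0, extOpenArm_mono hnn' hn'N h2, extOpenArm_mono hnn' hn'N h3, extOpenArm_mono hnn' hn'N h5⟩

/-! ### Locality -/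

/-- The norm shell `{n ≤ |v|_𝕋 ≤ R}` as a `Finset`. [folklore] -/
def normShellFin (n R : ℕ) : Finset (Site 2) := (triBall R).filter fun v => (n : ℤ) ≤ triNorm v

/-- Membership in the norm shell. [folklore] -/
theorem mem_normShellFin {n R : ℕ} {v : Site 2} : v ∈ normShellFin n R ↔ (n : ℤ) ≤ triNorm v ∧ triNorm v ≤ R := by
  rw [normShellFin, Finset.mem_filter, mem_triBall_iff]; tauto

/-- An event determined by a set of sites is determined by the complemented configuration on the
same set. [folklore] -/
theorem DeterminedBy.preimage_compl' {E : Set (SiteConfig (Site 2))} {S : Set (Site 2)} (hE : DeterminedBy E S) :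
    DeterminedBy {ω : SiteConfig (Site 2) | ωᶜ ∈ E} S := by
  rw [determinedBy_iff] at hE ⊢
  intro ω ω' h
  simp only [Set.mem_setOf_eq]
  apply hE
  ext v
  simp only [Set.mem_inter_iff, Set.mem_compl_iff]
  constructor
  · rintro ⟨hv, hvS⟩
    refine ⟨fun hv' => hv ?_, hvS⟩
    have : v ∈ ω' ∩ S := ⟨hv', hvS⟩
    rw [← h] at this
    exact this.1
  · rintro ⟨hv, hvS⟩
    refine ⟨fun hv' => hv ?_, hvS⟩
    have : v ∈ ω ∩ S := ⟨hv', hvS⟩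
    rw [h] at this
    exact this.1

/-- The framed / colour-exchanged landed-arm events are determined by the norm shell
`{n ≤ |v| ≤ N + N/8}` (`2n ≤ N`, `i < 6`). [folklore] -/
theorem determinedBy_frameConfig_mem_extOpenArm {n N i : ℕ} (hnN : 2 * n ≤ N) (hi : i < 6) :
    DeterminedBy {ω : SiteConfig (Site 2) | frameConfig i ω ∈ extOpenArm n N} ↑(normShellFin n (N + N / 8)) ∧
      DeterminedBy {ω : SiteConfig (Site 2) | frameConfig i ωᶜ ∈ extOpenArm n N} ↑(normShellFin n (N + N / 8)) := by
  have hE := determinedBy_preimage_frameConfig i (determinedBy_extOpenArm hnN)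
  have hsub : frameIso i '' extSupportSet n N ⊆ ↑(normShellFin n (N + N / 8)) := by
    rintro v ⟨u, hu, rfl⟩
    rw [mem_extSupportSet] at hu
    rw [Finset.mem_coe, mem_normShellFin, triNorm_frameIso i hi]
    exact ⟨hu.1, by push_cast; exact hu.2.1⟩
  refine ⟨hE.mono hsub, ?_⟩
  have h2 : {ω : SiteConfig (Site 2) | frameConfig i ωᶜ ∈ extOpenArm n N} =
      {ω : SiteConfig (Site 2) | ωᶜ ∈ {χ : SiteConfig (Site 2) | frameConfig i χ ∈ extOpenArm n N}} := by
    ext ω; simp only [Set.mem_setOf_eq]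
  rw [h2]
  exact (DeterminedBy.preimage_compl' hE).mono hsub

/-- **Locality of the landed four-arm event**: `extFourArmQ n N` is determined by the sites of the
norm shell `{n ≤ |v| ≤ N + N/8}` (`2n ≤ N`). [folklore] -/
theorem determinedBy_extFourArmQ {n N : ℕ} (hnN : 2 * n ≤ N) :
    DeterminedBy (extFourArmQ n N) ↑(normShellFin n (N + N / 8)) := by
  have h0 := (determinedBy_frameConfig_mem_extOpenArm hnN (show 0 < 6 by norm_num)).1
  have h2 := (determinedBy_frameConfig_mem_extOpenArm hnN (show 2 < 6 by norm_num)).2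
  have h3 := (determinedBy_frameConfig_mem_extOpenArm hnN (show 3 < 6 by norm_num)).1
  have h5 := (determinedBy_frameConfig_mem_extOpenArm hnN (show 5 < 6 by norm_num)).2
  have h0' : {ω : SiteConfig (Site 2) | frameConfig 0 ω ∈ extOpenArm n N} = extOpenArm n N := by
    ext ω
    simp only [Set.mem_setOf_eq]
    have : frameConfig 0 ω = ω := by ext v; rw [mem_frameConfig]; rfl
    rw [this]
  rw [h0'] at h0
  have heq : extFourArmQ n N = extOpenArm n N ∩ {ω | frameConfig 2 ωᶜ ∈ extOpenArm n N} ∩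
      {ω | frameConfig 3 ω ∈ extOpenArm n N} ∩ {ω | frameConfig 5 ωᶜ ∈ extOpenArm n N} := by
    ext ω; simp only [extFourArmQ, Set.mem_setOf_eq, Set.mem_inter_iff, and_assoc]
  rw [heq]
  exact ((h0.inter h2).inter h3).inter h5

/-- The landed four-arm event is measurable (`2n ≤ N`). [folklore] -/
theorem measurableSet_extFourArmQ {n N : ℕ} (hnN : 2 * n ≤ N) : MeasurableSet (extFourArmQ n N) :=
  (determinedBy_extFourArmQ hnN).measurableSet_of_finset

/-! ### The four arms as coloured paths of `ω` -/

/-- **Reading a framed landed arm in the original configuration.** If `frameConfig i χ ∈ extOpenArm n N`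
(`i < 6`) then `χ` has a landing site `z ∈ sepLanding N`, an attaching site `u'` with the outer free
space of the frame crossed through `u'`, and a `χ`-open path inside the framed region
`frameIso i ({n ≤ |v| ≤ N} ∪ S̊_{N/8}(z))` from a site of norm `n` to `frameIso i u'`; moreover
`u' 0 ≥ N + 1`. [folklore] -/
theorem exists_path_of_frameConfig_mem_extOpenArm {n N : ℕ} (i : ℕ) {χ : SiteConfig (Site 2)}
    (h : frameConfig i χ ∈ extOpenArm n N) :
    ∃ z u' a : Site 2, z ∈ sepLanding N ∧ triNorm a = n ∧ (N : ℤ) + 1 ≤ u' 0 ∧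
      OpenVCrossThrough (sepOuterFence N z) (z 1 - (N / 64 : ℕ)) (z 1 + (N / 64 : ℕ)) (frameConfig i χ) u' ∧
      PathIn triGraph ((frameIso i '' (triAnnulusSet n N ∪ triOpenBall z (N / 8))) ∩ χ) (frameIso i a) (frameIso i u') := by
  obtain ⟨z, u', a, hz, ha, hOut, p⟩ := h
  have hu' : (N : ℤ) + 1 ≤ u' 0 := by
    obtain ⟨b, t, -, -, q, -⟩ := hOut
    exact (mem_sepOuterFence.1 q.right_mem.1).1
  refine ⟨z, u', a, hz, ha, hu', hOut, ?_⟩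
  have p' : PathIn triGraph ((triAnnulusSet n N ∪ triOpenBall z (N / 8)) ∩ {v | v ∈ frameConfig i χ ↔ true}) a u' :=
    p.mono fun v hv => ⟨hv.1, by simpa using hv.2⟩
  exact (pathIn_of_frameConfig i p').mono fun v hv => ⟨hv.1, by simpa using hv.2⟩

/-- **Where the arm region is**: a site of `{n ≤ |v| ≤ N} ∪ S̊_{N/8}(z)`, `z ∈ sepLanding N`, has
`|v 1| ≤ N` and `-N ≤ v 0`. [folklore] -/
theorem abs_apply_one_le_of_mem_extRegion {n N : ℕ} {z v : Site 2} (hz : z ∈ sepLanding N)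
    (hv : v ∈ triAnnulusSet n N ∪ triOpenBall z (N / 8)) : |v 1| ≤ N ∧ -(N : ℤ) ≤ v 0 := by
  rw [mem_sepLanding] at hz
  rcases hv with hv | hv
  · rw [mem_triAnnulusSet] at hv
    have h := triNorm_le_iff_lin.1 hv.2
    exact ⟨abs_le.2 ⟨by omega, by omega⟩, by omega⟩
  · rw [mem_triOpenBall, triNorm_lt_iff_lin] at hv
    simp only [Pi.sub_apply] at hv
    have hN4 : ((N / 4 : ℕ) : ℤ) ≤ N := by exact_mod_cast Nat.div_le_self N 4
    have hN8 : 8 * ((N / 8 : ℕ) : ℤ) ≤ N := by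
      have := Nat.mul_div_le N 8; push_cast at this ⊢; linarith
    refine ⟨abs_le.2 ⟨by omega, by omega⟩, by omega⟩

/-! ### Crossings of the square box from long paths -/

/-- **A left–right crossing of `[-N, N]²` from a long horizontal path**: a path inside `A` from a site
with `x₀ ≤ -N` to a site with `x₀ ≥ N`, all of whose sites have `|x₁| ≤ N`, contains a path inside
`[-N, N]² ∩ A` from `{x₀ = -N}` to `{x₀ = N}` (first arrival at `x₀ = N`, then last departure from
`x₀ = -N`; a step of `𝕋` changes `x₀` by at most one). [folklore] -/
theorem exists_lr_crossing_of_pathIn {N : ℕ} (hN : 1 ≤ N) {A : Set (Site 2)} (hA : ∀ v ∈ A, |v 1| ≤ N)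
    {x y : Site 2} (hx : x 0 ≤ -(N : ℤ)) (hy : (N : ℤ) ≤ y 0) (hP : PathIn triGraph A x y) :
    ∃ x' y' : Site 2, x' 0 = -(N : ℤ) ∧ y' 0 = N ∧ PathIn triGraph (triSqBox N ∩ A) x' y' := by
  -- first arrival at `x₀ ≥ N`
  have hxR : x ∈ {v : Site 2 | v 0 < N} := by show x 0 < N; omega
  obtain ⟨a, b, haR, hbR, hbA, hab, hP1⟩ := hP.exit hxR (show ¬ y 0 < N from not_lt.2 hy)
  simp only [Set.mem_setOf_eq, not_lt] at haR hbR
  have hb0 : b 0 = N := by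
    rcases (triGraph_adj_iff_coord a b).1 hab with h | h | h | h | h | h <;> omega
  have hsub : {v : Site 2 | v 0 < N} ∩ A ⊆ {v : Site 2 | v 0 ≤ N} ∩ A := fun v hv => ⟨le_of_lt (show v 0 < N from hv.1), hv.2⟩
  have hP2 : PathIn triGraph ({v : Site 2 | v 0 ≤ N} ∩ A) x b := (hP1.mono hsub).tail hab ⟨hb0.le, hbA⟩
  -- last departure from `x₀ ≤ -N`, read on the reversed path
  have hbR' : b ∈ {v : Site 2 | -(N : ℤ) < v 0} := by show -(N : ℤ) < b 0; omega
  obtain ⟨a', b', ha'R, hb'R, hb'A, ha'b', hQ⟩ := hP2.symm.exit hbR' (show ¬ (-(N : ℤ) < x 0) from not_lt.2 hx)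
  simp only [Set.mem_setOf_eq, not_lt] at ha'R hb'R
  have hb'0 : b' 0 = -(N : ℤ) := by
    rcases (triGraph_adj_iff_coord a' b').1 ha'b' with h | h | h | h | h | h <;> omega
  have hsub' : {v : Site 2 | -(N : ℤ) < v 0} ∩ ({v : Site 2 | v 0 ≤ N} ∩ A) ⊆ triSqBox N ∩ A := by
    rintro v ⟨hv1, hv2, hv3⟩
    have h1 : -(N : ℤ) < v 0 := hv1
    have h2 : v 0 ≤ N := hv2
    exact ⟨mem_triSqBox.2 ⟨abs_le.2 ⟨h1.le, h2⟩, hA v hv3⟩, hv3⟩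
  have hb'box : b' ∈ triSqBox N ∩ A := ⟨mem_triSqBox.2 ⟨abs_le.2 ⟨hb'0.ge, by omega⟩, hA b' hb'A.2⟩, hb'A.2⟩
  have hQ' : PathIn triGraph (triSqBox N ∩ A) b b' := (hQ.mono hsub').tail ha'b' hb'box
  exact ⟨b', b, hb'0, hb0, hQ'.symm⟩

/-- **A bottom–top crossing of `[-N, N]²` from a long vertical path** (the transposed statement). [folklore] -/
theorem exists_bt_crossing_of_pathIn {N : ℕ} (hN : 1 ≤ N) {A : Set (Site 2)} (hA : ∀ v ∈ A, |v 0| ≤ N)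
    {x y : Site 2} (hx : x 1 ≤ -(N : ℤ)) (hy : (N : ℤ) ≤ y 1) (hP : PathIn triGraph A x y) :
    ∃ x' y' : Site 2, x' 1 = -(N : ℤ) ∧ y' 1 = N ∧ PathIn triGraph (triSqBox N ∩ A) x' y' := by
  have hxR : x ∈ {v : Site 2 | v 1 < N} := by show x 1 < N; omega
  obtain ⟨a, b, haR, hbR, hbA, hab, hP1⟩ := hP.exit hxR (show ¬ y 1 < N from not_lt.2 hy)
  simp only [Set.mem_setOf_eq, not_lt] at haR hbR
  have hb0 : b 1 = N := by
    rcases (triGraph_adj_iff_coord a b).1 hab with h | h | h | h | h | h <;> omega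
  have hsub : {v : Site 2 | v 1 < N} ∩ A ⊆ {v : Site 2 | v 1 ≤ N} ∩ A := fun v hv => ⟨le_of_lt (show v 1 < N from hv.1), hv.2⟩
  have hP2 : PathIn triGraph ({v : Site 2 | v 1 ≤ N} ∩ A) x b := (hP1.mono hsub).tail hab ⟨hb0.le, hbA⟩
  have hbR' : b ∈ {v : Site 2 | -(N : ℤ) < v 1} := by show -(N : ℤ) < b 1; omega
  obtain ⟨a', b', ha'R, hb'R, hb'A, ha'b', hQ⟩ := hP2.symm.exit hbR' (show ¬ (-(N : ℤ) < x 1) from not_lt.2 hx)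
  simp only [Set.mem_setOf_eq, not_lt] at ha'R hb'R
  have hb'0 : b' 1 = -(N : ℤ) := by
    rcases (triGraph_adj_iff_coord a' b').1 ha'b' with h | h | h | h | h | h <;> omega
  have hsub' : {v : Site 2 | -(N : ℤ) < v 1} ∩ ({v : Site 2 | v 1 ≤ N} ∩ A) ⊆ triSqBox N ∩ A := by
    rintro v ⟨hv1, hv2, hv3⟩
    have h1 : -(N : ℤ) < v 1 := hv1
    have h2 : v 1 ≤ N := hv2
    exact ⟨mem_triSqBox.2 ⟨hA v hv3, abs_le.2 ⟨h1.le, h2⟩⟩, hv3⟩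
  have hb'box : b' ∈ triSqBox N ∩ A := ⟨mem_triSqBox.2 ⟨hA b' hb'A.2, abs_le.2 ⟨hb'0.ge, by omega⟩⟩, hb'A.2⟩
  have hQ' : PathIn triGraph (triSqBox N ∩ A) b b' := (hQ.mono hsub').tail ha'b' hb'box
  exact ⟨b', b, hb'0, hb0, hQ'.symm⟩

/-! ### The square Hex lemma for the landing pattern -/

/-- **No open left–right bridge in presence of the two closed landed arms.** Let the closed arms of
the pattern be present: `frameConfig 2 ωᶜ ∈ extOpenArm m N` (a closed arm from `∂Λ_m` landed on the
top side of `∂Λ_N`) and `frameConfig 5 ωᶜ ∈ extOpenArm m N` (on the bottom side), `1 ≤ m ≤ N`. Then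
no OPEN set `B` of sites outside the hole `Λ_{m-1}` and inside the strip `|x₁| ≤ N` carries a path
from `{x₀ ≤ -N}` to `{x₀ ≥ N}`. Indeed the two closed arms, joined through the hole (which is
disjoint from `B`), give a bottom–top crossing of `[-N, N]²` inside `Bᶜ`, while `B` gives a
left–right crossing inside `B` (`tri_hex_excl_triSqBox`). [cite: BollobasRiordan2006, Ch. 5 Lemma 7] [cite: Nolin2008, §4.2 (arXiv 0711.4948: Def. 7–8, arms landed on prescribed sides)] -/
theorem hexQ_open_excl {m N : ℕ} (hm : 1 ≤ m) (hmN : m ≤ N) {ω : SiteConfig (Site 2)}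
    (h2 : frameConfig 2 ωᶜ ∈ extOpenArm m N) (h5 : frameConfig 5 ωᶜ ∈ extOpenArm m N)
    {B : Set (Site 2)} (hBω : B ⊆ ω) (hBm : ∀ v ∈ B, (m : ℤ) ≤ triNorm v) (hB1 : ∀ v ∈ B, |v 1| ≤ N)
    {x y : Site 2} (hx : x 0 ≤ -(N : ℤ)) (hy : (N : ℤ) ≤ y 0) (hP : PathIn triGraph B x y) : False := by
  have hN : 1 ≤ N := le_trans hm hmN
  -- the black crossing
  obtain ⟨x', y', hx', hy', hblack⟩ := exists_lr_crossing_of_pathIn hN hB1 hx hy hP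
  -- the two closed arms, read in `ω`
  obtain ⟨z₂, u₂, a₂, hz₂, ha₂, hu₂, -, P₂⟩ := exists_path_of_frameConfig_mem_extOpenArm 2 h2
  obtain ⟨z₅, u₅, a₅, hz₅, ha₅, hu₅, -, P₅⟩ := exists_path_of_frameConfig_mem_extOpenArm 5 h5
  -- the white region: `|x₀| ≤ N`, off `B`
  set A : Set (Site 2) := {v | |v 0| ≤ N} ∩ Bᶜ with hA
  have hA0 : ∀ v ∈ A, |v 0| ≤ N := fun v hv => hv.1
  have reg2 : ∀ v ∈ (frameIso 2 '' (triAnnulusSet m N ∪ triOpenBall z₂ (N / 8))) ∩ ωᶜ, v ∈ A := by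
    rintro v ⟨⟨u, hu, rfl⟩, hvω⟩
    obtain ⟨h1, -⟩ := abs_apply_one_le_of_mem_extRegion hz₂ hu
    obtain ⟨-, -, -, -, f0, -⟩ := frameIso_apply_formula u
    exact ⟨by show |(frameIso 2 u) 0| ≤ N; rw [f0]; exact h1, fun hvB => hvω (hBω hvB)⟩
  have reg5 : ∀ v ∈ (frameIso 5 '' (triAnnulusSet m N ∪ triOpenBall z₅ (N / 8))) ∩ ωᶜ, v ∈ A := by
    rintro v ⟨⟨u, hu, rfl⟩, hvω⟩
    obtain ⟨h1, -⟩ := abs_apply_one_le_of_mem_extRegion hz₅ hu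
    obtain ⟨-, -, -, -, -, -, -, -, -, -, f0, -⟩ := frameIso_apply_formula u
    exact ⟨by show |(frameIso 5 u) 0| ≤ N; rw [f0, abs_neg]; exact h1, fun hvB => hvω (hBω hvB)⟩
  have Q₂ : PathIn triGraph A (frameIso 2 a₂) (frameIso 2 u₂) := P₂.mono fun v hv => reg2 v hv
  have Q₅ : PathIn triGraph A (frameIso 5 a₅) (frameIso 5 u₅) := P₅.mono fun v hv => reg5 v hv
  -- through the hole
  have hole : ∀ v : Site 2, triNorm v ≤ (m - 1 : ℕ) → v ∈ A := fun v hv => by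
    have hv' : triNorm v ≤ (m : ℤ) - 1 := by
      have : ((m - 1 : ℕ) : ℤ) = m - 1 := by omega
      rw [this] at hv; exact hv
    refine ⟨?_, fun hvB => by have := hBm v hvB; omega⟩
    have h := triNorm_le_iff_lin.1 hv'
    have hmN' : (m : ℤ) ≤ N := by exact_mod_cast hmN
    show |v 0| ≤ N
    exact abs_le.2 ⟨by omega, by omega⟩
  have hn₂ : triNorm (frameIso 2 a₂) = m := by rw [triNorm_frameIso 2 (by norm_num), ha₂]
  have hn₅ : triNorm (frameIso 5 a₅) = m := by rw [triNorm_frameIso 5 (by norm_num), ha₅]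
  obtain ⟨h₂, hadj₂, hh₂⟩ := exists_adj_mem_triBall_sub_one hm hn₂
  obtain ⟨h₅, hadj₅, hh₅⟩ := exists_adj_mem_triBall_sub_one hm hn₅
  have Qh : PathIn triGraph A h₅ h₂ :=
    (pathIn_triBall hh₅ hh₂).mono fun v hv => hole v (mem_triBall_iff.1 (Finset.mem_coe.1 hv))
  have Q : PathIn triGraph A (frameIso 5 u₅) (frameIso 2 u₂) :=
    ((Q₅.symm.trans (PathIn.of_adj Q₅.left_mem Qh.left_mem hadj₅)).trans Qh).trans
      ((PathIn.of_adj Qh.right_mem Q₂.left_mem hadj₂.symm).trans Q₂)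
  -- the white crossing
  obtain ⟨-, -, -, -, -, -, -, -, -, -, -, f5⟩ := frameIso_apply_formula u₅
  obtain ⟨-, -, -, -, -, f2, -⟩ := frameIso_apply_formula u₂
  obtain ⟨x'', y'', hx'', hy'', hwhite⟩ := exists_bt_crossing_of_pathIn hN hA0 (x := frameIso 5 u₅) (y := frameIso 2 u₂)
    (by rw [f5]; omega) (by rw [f2]; omega) Q
  exact tri_hex_excl_triSqBox N B hx' hy' hblack hx'' hy'' (hwhite.mono fun v hv => ⟨hv.1, hv.2.2⟩)

/-- **No closed bottom–top bridge in presence of the two open landed arms** (the transposed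
statement, through `σ = frameIso 2`): if `ω ∈ extOpenArm m N` and `frameConfig 3 ω ∈ extOpenArm m N`
(open arms landed on the right and left sides), `1 ≤ m ≤ N`, then no CLOSED set `W` of sites
outside the hole and inside the strip `|x₀| ≤ N` carries a path from `{x₁ ≤ -N}` to `{x₁ ≥ N}`. [cite: BollobasRiordan2006, Ch. 5 Lemma 7] [cite: Nolin2008, §4.2 (arXiv 0711.4948: Def. 7–8)] -/
theorem hexQ_closed_excl {m N : ℕ} (hm : 1 ≤ m) (hmN : m ≤ N) {ω : SiteConfig (Site 2)}
    (h0 : ω ∈ extOpenArm m N) (h3 : frameConfig 3 ω ∈ extOpenArm m N)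
    {W : Set (Site 2)} (hWω : W ⊆ ωᶜ) (hWm : ∀ v ∈ W, (m : ℤ) ≤ triNorm v) (hW0 : ∀ v ∈ W, |v 0| ≤ N)
    {x y : Site 2} (hx : x 1 ≤ -(N : ℤ)) (hy : (N : ℤ) ≤ y 1) (hP : PathIn triGraph W x y) : False := by
  set ω' : SiteConfig (Site 2) := frameConfig 2 ωᶜ with hω'
  have hc : ω'ᶜ = frameConfig 2 ω := by rw [hω', frameConfig_compl, compl_compl]
  have h2' : frameConfig 2 ω'ᶜ ∈ extOpenArm m N := by rw [hc, frameConfig_two_two]; exact h0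
  have h5' : frameConfig 5 ω'ᶜ ∈ extOpenArm m N := by rw [hc, frameConfig_five_two]; exact h3
  refine hexQ_open_excl hm hmN h2' h5' (B := frameIso 2 '' W) ?_ ?_ ?_ (x := frameIso 2 x) (y := frameIso 2 y) ?_ ?_
    (pathIn_map_iso (frameIso 2) hP)
  · rintro v ⟨w, hw, rfl⟩
    show frameIso 2 w ∈ frameConfig 2 ωᶜ
    rw [mem_frameConfig, frameIso_two_two]
    exact hWω hw
  · rintro v ⟨w, hw, rfl⟩
    rw [triNorm_frameIso 2 (by norm_num)]
    exact hWm w hw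
  · rintro v ⟨w, hw, rfl⟩
    obtain ⟨-, -, -, -, -, f1, -⟩ := frameIso_apply_formula w
    rw [f1]; exact hW0 w hw
  · obtain ⟨-, -, -, -, f0, -⟩ := frameIso_apply_formula x
    rw [f0]; exact hx
  · obtain ⟨-, -, -, -, f0, -⟩ := frameIso_apply_formula y
    rw [f0]; exact hy

/-- **The two open arms of `extFourArmQ` are not joined by an open path outside the hole and inside
the strip `|x₁| ≤ N`**: for `ω ∈ extFourArmQ m N` (`1 ≤ m ≤ N`), an `ω`-open path inside
`{m ≤ |v|} ∩ {|v 1| ≤ N}` never joins a site `x` openly joined (inside the same region) to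
`{x₀ ≥ N}` with a site `y` openly joined to `{x₀ ≤ -N}`. In particular the open clusters of the two open
arms inside the annulus `{m ≤ |v| ≤ N}` are distinct. [cite: Nolin2008, §4.1–4.2 (arXiv 0711.4948: the events `Ã̃`, arms landed on prescribed sides)] -/
theorem extFourArmQ_open_not_joined {m N : ℕ} (hm : 1 ≤ m) (hmN : m ≤ N) {ω : SiteConfig (Site 2)}
    (hω : ω ∈ extFourArmQ m N) {x y p q : Site 2} (hp : (N : ℤ) ≤ p 0) (hq : q 0 ≤ -(N : ℤ))
    (hxp : PathIn triGraph ({v : Site 2 | (m : ℤ) ≤ triNorm v ∧ |v 1| ≤ N} ∩ ω) x p)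
    (hyq : PathIn triGraph ({v : Site 2 | (m : ℤ) ≤ triNorm v ∧ |v 1| ≤ N} ∩ ω) y q)
    (hxy : PathIn triGraph ({v : Site 2 | (m : ℤ) ≤ triNorm v ∧ |v 1| ≤ N} ∩ ω) x y) : False :=
  hexQ_open_excl hm hmN hω.2.1 hω.2.2.2 (B := {v : Site 2 | (m : ℤ) ≤ triNorm v ∧ |v 1| ≤ N} ∩ ω)
    Set.inter_subset_right (fun _ hv => hv.1.1) (fun _ hv => hv.1.2) hq hp ((hyq.symm.trans hxy.symm).trans hxp)

/-- **The two closed arms of `extFourArmQ` are not joined by a closed path outside the hole and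
inside the strip `|x₀| ≤ N`.** [cite: Nolin2008, §4.1–4.2 (arXiv 0711.4948: the events `Ã̃`, arms landed on prescribed sides)] -/
theorem extFourArmQ_closed_not_joined {m N : ℕ} (hm : 1 ≤ m) (hmN : m ≤ N) {ω : SiteConfig (Site 2)}
    (hω : ω ∈ extFourArmQ m N) {x y p q : Site 2} (hp : (N : ℤ) ≤ p 1) (hq : q 1 ≤ -(N : ℤ))
    (hxp : PathIn triGraph ({v : Site 2 | (m : ℤ) ≤ triNorm v ∧ |v 0| ≤ N} \ ω) x p)
    (hyq : PathIn triGraph ({v : Site 2 | (m : ℤ) ≤ triNorm v ∧ |v 0| ≤ N} \ ω) y q)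
    (hxy : PathIn triGraph ({v : Site 2 | (m : ℤ) ≤ triNorm v ∧ |v 0| ≤ N} \ ω) x y) : False :=
  hexQ_closed_excl hm hmN hω.1 hω.2.2.1 (W := {v : Site 2 | (m : ℤ) ≤ triNorm v ∧ |v 0| ≤ N} \ ω)
    (fun _ hv => hv.2) (fun _ hv => hv.1.1) (fun _ hv => hv.1.2) hq hp ((hyq.symm.trans hxy.symm).trans hxp)

end Literature.Probability.Percolation
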